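import Literature.Analysis.Complex.PositiveKernelContinuation
import Literature.Analysis.Complex.DbarPoincarePolydisc
import Mathlib.Analysis.Calculus.FDeriv.Pi
import HarnessLib

/-!
# Propagation of positive-definiteness to polydiscs with real centres

Analysis/Complex support file (everything proved; no named facts), sequel of
`PositiveKernelContinuation` (Glaser's lemma in one complex variable with parameters, on the right
half-plane). Here: the **several-variable form on polydiscs**. Let
`P = D(ξ, r) = {z ∈ ℂᵐ | |zᵢ - ξᵢ| < rᵢ}` be an open polydisc with *real* centre `ξ ∈ ℝᵐ`, and let
`K` be a kernel on `ℂᵐ` which on `P` is sesqui-holomorphic, `K (w, z) = k (w̄, z)` with `k` jointly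
holomorphic on `P × P`. If `K` is positive-semidefinite on the real points `P ∩ ℝᵐ` then it is
positive-semidefinite on all of `P` (`isPosSemidefKernelOn_polydisc_of_real`).

This is the positivity half of the step (P_N) of Osterwalder–Schrader II (Comm. Math. Phys. 42
(1975), Ch. V.2, (5.16)–(5.21): the vectors `Ψₙ(x, ζ)` at complex time differences `ζ` in a
polydisc `P` about real points, whose Gram kernel is the continued Schwinger function
`S_{2n-1}(θζ', 2x, ζ)` on `P̄ × P`), in the form of V. Glaser, Comm. Math. Phys. 37 (1974), §2
("positivity propagates to the whole domain of holomorphy"): see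
`Literature/MathematicalPhysics/QuantumFieldTheory/OSHolomorphicVectors.lean` for the vectors.

## Proof

Induction on the number of complexified coordinates: `A_j = {z ∈ P | zᵢ ∈ ℝ for i ≥ j}`, `A₀` the
real points, `A_m = P`. The step `A_j ⇒ A_{j+1}` is the one-variable lemma
`isPosSemidefKernelOn_halfPlane_of_ofReal` with parameter space `A_j` and the `j`-th coordinate
transported from the right half-plane `Π` to the disc `D(ξⱼ, rⱼ)` by the Cayley map
`s ↦ ξⱼ + rⱼ (s - 1)/(s + 1)` (`cayleyDisc`), which maps `Π` onto the disc, `(0, ∞)` into the real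
diameter, and commutes with complex conjugation (so that sesqui-holomorphy is preserved); the joint
holomorphy of the transported two-variable kernels gives their bounded double Taylor expansions
(`hasLocalTaylor₂_of_differentiableOn`).

## References

* V. Glaser, *On the equivalence of the Euclidean and Wightman formulation of field theory*,
  Comm. Math. Phys. 37 (1974) 257–272, §2. [GlaserCMP1974]
* K. Osterwalder, R. Schrader, *Axioms for Euclidean Green's functions II*, Comm. Math. Phys. 42
  (1975) 281–305, Ch. V.2 (5.16)–(5.21). [OsterwalderSchraderCMP1975]
-/

noncomputable section

open Metric Set Filter Complex
open scoped Topology ComplexOrder ComplexConjugate BigOperators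

namespace Literature.Analysis.Complex

/-! ### Positive-semidefinite kernels: congruence -/

/-- Positive-semidefiniteness on `A` only depends on the values of the kernel on `A × A`. [folklore] -/
theorem IsPosSemidefKernelOn.of_eqOn {α : Type*} {K K' : α → α → ℂ} {A : Set α}
    (h : IsPosSemidefKernelOn K A) (hKK' : ∀ x ∈ A, ∀ y ∈ A, K' x y = K x y) :
    IsPosSemidefKernelOn K' A := by
  intro m x hx c
  have := h m x hx c
  simpa only [hKK' _ (hx _) _ (hx _)] using this

/-! ### The Cayley map of the right half-plane onto a disc with real centre -/

/-- The **Cayley map** `s ↦ ξ + r (s - 1)/(s + 1)` of the right half-plane `{Re s > 0}` onto the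
disc `D(ξ, r)` with real centre `ξ ∈ ℝ` and radius `r > 0`; it maps `(0, ∞)` into the real
diameter and commutes with complex conjugation. [folklore] -/
def cayleyDisc (ξ r : ℝ) (s : ℂ) : ℂ := (ξ : ℂ) + (r : ℂ) * ((s - 1) / (s + 1))

/-- The inverse Cayley map `z ↦ (1 + t)/(1 - t)`, `t = (z - ξ)/r`, of the disc `D(ξ, r)` onto the
right half-plane. [folklore] -/
def cayleyDiscInv (ξ r : ℝ) (z : ℂ) : ℂ := (1 + (z - ξ) / r) / (1 - (z - ξ) / r)

/-- `s + 1 ≠ 0` on the right half-plane (a private copy of the helper of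
`ConformalRadiusBoundary`, to keep the imports of this file small). [folklore] -/
private theorem Cayley.add_one_ne_zero_of_re_pos {s : ℂ} (hs : 0 < s.re) : s + 1 ≠ 0 := fun h => by
  have := congrArg Complex.re h
  simp only [Complex.add_re, Complex.one_re, Complex.zero_re] at this
  linarith

/-- `|(s - 1)/(s + 1)| < 1` for `Re s > 0` (private copy of `norm_cayley_lt_one` of
`ConformalRadiusBoundary`, same reason). [folklore] -/
private theorem Cayley.norm_sub_one_div_add_one_lt_one {s : ℂ} (hs : 0 < s.re) : ‖(s - 1) / (s + 1)‖ < 1 := by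
  rw [norm_div, div_lt_one (norm_pos_iff.2 (Cayley.add_one_ne_zero_of_re_pos hs))]
  have h : ‖s - 1‖ ^ 2 < ‖s + 1‖ ^ 2 := by
    rw [Complex.sq_norm, Complex.sq_norm, Complex.normSq_apply, Complex.normSq_apply]
    simp only [Complex.sub_re, Complex.one_re, Complex.sub_im, Complex.one_im, sub_zero,
      Complex.add_re, Complex.add_im, add_zero]
    nlinarith
  exact lt_of_pow_lt_pow_left₀ 2 (norm_nonneg _) h

/-- The Cayley map sends the right half-plane into the disc. [folklore] -/
theorem cayleyDisc_mem_ball {ξ r : ℝ} (hr : 0 < r) {s : ℂ} (hs : 0 < s.re) :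
    cayleyDisc ξ r s ∈ ball (ξ : ℂ) r := by
  rw [mem_ball, dist_eq_norm, cayleyDisc, add_sub_cancel_left, norm_mul, Complex.norm_real,
    Real.norm_eq_abs, abs_of_pos hr]
  calc r * ‖(s - 1) / (s + 1)‖ < r * 1 :=
        mul_lt_mul_of_pos_left (Cayley.norm_sub_one_div_add_one_lt_one hs) hr
    _ = r := mul_one r

/-- The Cayley map is holomorphic on the right half-plane. [folklore] -/
theorem differentiableOn_cayleyDisc (ξ r : ℝ) :
    DifferentiableOn ℂ (cayleyDisc ξ r) {s : ℂ | 0 < s.re} := by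
  intro s hs
  have h : DifferentiableAt ℂ (fun s : ℂ => (s - 1) / (s + 1)) s :=
    (differentiableAt_id.sub_const 1).div (differentiableAt_id.add_const 1)
      (Cayley.add_one_ne_zero_of_re_pos hs)
  exact ((h.const_mul (r : ℂ)).const_add (ξ : ℂ)).differentiableWithinAt

/-- The Cayley map commutes with complex conjugation. [folklore] -/
theorem cayleyDisc_conj (ξ r : ℝ) (s : ℂ) : cayleyDisc ξ r (conj s) = conj (cayleyDisc ξ r s) := by
  simp only [cayleyDisc, map_add, map_mul, map_div₀, map_sub, map_one, Complex.conj_ofReal]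

/-- The Cayley map is real on the real axis. [folklore] -/
theorem cayleyDisc_ofReal (ξ r t : ℝ) :
    cayleyDisc ξ r (t : ℂ) = ((ξ + r * ((t - 1) / (t + 1)) : ℝ) : ℂ) := by
  simp only [cayleyDisc]
  push_cast
  ring

/-- … hence has vanishing imaginary part there. [folklore] -/
theorem cayleyDisc_ofReal_im (ξ r t : ℝ) : (cayleyDisc ξ r (t : ℂ)).im = 0 := by
  rw [cayleyDisc_ofReal, Complex.ofReal_im]

/-- The inverse Cayley map sends the disc into the right half-plane. [folklore] -/
theorem cayleyDiscInv_re_pos {ξ r : ℝ} (hr : 0 < r) {z : ℂ} (hz : z ∈ ball (ξ : ℂ) r) :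
    0 < (cayleyDiscInv ξ r z).re := by
  set t : ℂ := (z - ξ) / r with ht_def
  have ht : ‖t‖ < 1 := by
    rw [ht_def, norm_div, Complex.norm_real, Real.norm_eq_abs, abs_of_pos hr, div_lt_one hr]
    rwa [mem_ball, dist_eq_norm] at hz
  have h1 : (1 : ℂ) - t ≠ 0 := fun h => by
    have : t = 1 := (sub_eq_zero.1 h).symm
    rw [this, norm_one] at ht
    exact lt_irrefl _ ht
  have hw : 0 < Complex.normSq (1 - t) := Complex.normSq_pos.2 h1
  show 0 < ((1 + t) / (1 - t)).re
  rw [Complex.div_re, ← add_div]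
  refine div_pos ?_ hw
  have hnum : (1 + t).re * (1 - t).re + (1 + t).im * (1 - t).im = 1 - Complex.normSq t := by
    simp only [Complex.add_re, Complex.one_re, Complex.sub_re, Complex.add_im, Complex.one_im,
      Complex.sub_im, zero_add, zero_sub, Complex.normSq_apply]
    ring
  rw [hnum, Complex.normSq_eq_norm_sq]
  nlinarith [norm_nonneg t]

/-- `cayleyDisc ∘ cayleyDiscInv = id` on the disc. [folklore] -/
theorem cayleyDisc_cayleyDiscInv {ξ r : ℝ} (hr : 0 < r) {z : ℂ} (hz : z ∈ ball (ξ : ℂ) r) :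
    cayleyDisc ξ r (cayleyDiscInv ξ r z) = z := by
  set t : ℂ := (z - ξ) / r with ht_def
  have ht : ‖t‖ < 1 := by
    rw [ht_def, norm_div, Complex.norm_real, Real.norm_eq_abs, abs_of_pos hr, div_lt_one hr]
    rwa [mem_ball, dist_eq_norm] at hz
  have h1 : (1 : ℂ) - t ≠ 0 := fun h => by
    have : t = 1 := (sub_eq_zero.1 h).symm
    rw [this, norm_one] at ht
    exact lt_irrefl _ ht
  have hr' : (r : ℂ) ≠ 0 := by exact_mod_cast hr.ne'
  have hs : cayleyDiscInv ξ r z = (1 + t) / (1 - t) := rfl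
  have hs1 : (1 + t) / (1 - t) + 1 = 2 / (1 - t) := by
    field_simp
    ring
  have hs2 : (1 + t) / (1 - t) - 1 = 2 * t / (1 - t) := by
    field_simp
    ring
  rw [cayleyDisc, hs, hs1, hs2, show (2 : ℂ) * t / (1 - t) / (2 / (1 - t)) = t by field_simp]
  rw [ht_def, mul_div_cancel₀ _ hr']
  ring

/-! ### Real-centred polydiscs -/

section Polydisc

variable {m : ℕ}

/-- A real-centred polydisc is stable under complex conjugation of the coordinates. [folklore] -/
theorem star_mem_polydisc_ofReal {ξ : Fin m → ℝ} {r : Fin m → ℝ} {z : Fin m → ℂ}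
    (hz : z ∈ polydisc (fun i => (ξ i : ℂ)) r) : star z ∈ polydisc (fun i => (ξ i : ℂ)) r := by
  rw [mem_polydisc] at hz ⊢
  intro i
  have h := hz i
  rw [mem_ball, dist_eq_norm] at h ⊢
  rw [Pi.star_apply, Complex.star_def, ← Complex.conj_ofReal, ← map_sub, Complex.norm_conj]
  exact h

/-- Updating one coordinate inside its disc keeps a point in the polydisc. [folklore] -/
theorem update_mem_polydisc {c : Fin m → ℂ} {r : Fin m → ℝ} {z : Fin m → ℂ}
    (hz : z ∈ polydisc c r) (J : Fin m) {v : ℂ} (hv : v ∈ ball (c J) (r J)) :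
    Function.update z J v ∈ polydisc c r := by
  rw [mem_polydisc] at hz ⊢
  intro i
  rcases eq_or_ne i J with rfl | hiJ
  · simpa using hv
  · rw [Function.update_of_ne hiJ]; exact hz i

/-- The real points of a real-centred polydisc with positive radii contain its centre. [folklore] -/
theorem ofReal_mem_polydisc {ξ : Fin m → ℝ} {r : Fin m → ℝ} (hr : ∀ i, 0 < r i) :
    (fun i => (ξ i : ℂ)) ∈ polydisc (fun i => (ξ i : ℂ)) r :=
  mem_polydisc.2 fun i => mem_ball_self (hr i)

/-- The **stages** of the induction: points of `P` whose coordinates of index `≥ j` are real. [folklore] -/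
def realStage (P : Set (Fin m → ℂ)) (j : ℕ) : Set (Fin m → ℂ) :=
  {z | z ∈ P ∧ ∀ i : Fin m, j ≤ i.val → (z i).im = 0}

/-- Stage `0` is the set of real points of `P`. [folklore] -/
theorem realStage_zero (P : Set (Fin m → ℂ)) :
    realStage P 0 = {z | z ∈ P ∧ ∀ i : Fin m, (z i).im = 0} := by
  ext z; simp [realStage]

/-- Stage `m` is all of `P`. [folklore] -/
theorem realStage_self (P : Set (Fin m → ℂ)) : realStage P m = P := by
  ext z
  simp only [realStage, mem_setOf_eq, and_iff_left_iff_imp]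
  intro _ i hi
  exact absurd i.isLt (not_lt.2 hi)

/-- **The induction step**: positive-semidefiniteness on the stage `j` propagates to the stage
`j + 1` (Glaser's one-variable lemma in the `j`-th coordinate, transported to the disc
`D(ξⱼ, rⱼ)` by the Cayley map, with the other coordinates as parameters). [cite: GlaserCMP1974, §2] -/
theorem isPosSemidefKernelOn_realStage_succ {ξ r : Fin m → ℝ} (hr : ∀ i, 0 < r i)
    {K k : (Fin m → ℂ) → (Fin m → ℂ) → ℂ}
    (hk : DifferentiableOn ℂ (Function.uncurry k)
      (polydisc (fun i => (ξ i : ℂ)) r ×ˢ polydisc (fun i => (ξ i : ℂ)) r))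
    (hK : ∀ w ∈ polydisc (fun i => (ξ i : ℂ)) r, ∀ z ∈ polydisc (fun i => (ξ i : ℂ)) r,
      K w z = k (star w) z)
    {j : ℕ} (hj : j < m)
    (hpos : IsPosSemidefKernelOn K (realStage (polydisc (fun i => (ξ i : ℂ)) r) j)) :
    IsPosSemidefKernelOn K (realStage (polydisc (fun i => (ξ i : ℂ)) r) (j + 1)) := by
  set P : Set (Fin m → ℂ) := polydisc (fun i => (ξ i : ℂ)) r with hP
  set J : Fin m := ⟨j, hj⟩ with hJ
  set φ : ℂ → ℂ := cayleyDisc (ξ J) (r J) with hφ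
  -- parameter space: the stage `j`
  set X := {x : Fin m → ℂ // x ∈ realStage P j}
  set emb : X × ℂ → (Fin m → ℂ) := fun p => Function.update p.1.1 J (φ p.2) with hemb
  set K' : X × ℂ → X × ℂ → ℂ := fun p q => K (emb p) (emb q) with hK'
  set k' : X → X → ℂ → ℂ → ℂ := fun x x' σ τ =>
    k (Function.update (star x.1) J (φ σ)) (Function.update x'.1 J (φ τ)) with hk'
  have hHalf : IsOpen {s : ℂ | 0 < s.re} := isOpen_lt continuous_const Complex.continuous_re
  -- the images of `emb` on the right half-plane lie in `P`
  have hembP : ∀ (x : X) {s : ℂ}, 0 < s.re → Function.update x.1 J (φ s) ∈ P := fun x s hs =>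
    update_mem_polydisc x.2.1 J (cayleyDisc_mem_ball (hr J) hs)
  have hembP' : ∀ (x : X) {s : ℂ}, 0 < s.re → Function.update (star x.1) J (φ s) ∈ P := fun x s hs =>
    update_mem_polydisc (star_mem_polydisc_ofReal x.2.1) J (cayleyDisc_mem_ball (hr J) hs)
  -- (1) bounded double Taylor expansions of the transported kernels
  have hk'T : ∀ x x', HasLocalTaylor₂ (k' x x') {s : ℂ | 0 < s.re} {s : ℂ | 0 < s.re} := by
    intro x x'
    refine hasLocalTaylor₂_of_differentiableOn ?_ hHalf hHalf
    have hinner : DifferentiableOn ℂ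
        (fun p : ℂ × ℂ => (Function.update (star x.1) J (φ p.1), Function.update x'.1 J (φ p.2)))
        ({s : ℂ | 0 < s.re} ×ˢ {s : ℂ | 0 < s.re}) := by
      refine DifferentiableOn.prodMk ?_ ?_
      · intro p hp
        have h1 : DifferentiableAt ℂ (Function.update (star x.1) J) (φ p.1) :=
          (hasFDerivAt_update (star x.1) (φ p.1)).differentiableAt
        have h2 : DifferentiableWithinAt ℂ (fun p : ℂ × ℂ => φ p.1) ({s : ℂ | 0 < s.re} ×ˢ {s : ℂ | 0 < s.re}) p :=
          ((differentiableOn_cayleyDisc (ξ J) (r J)) p.1 hp.1).comp p differentiableWithinAt_fst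
            (fun q hq => hq.1)
        exact h1.comp_differentiableWithinAt p h2
      · intro p hp
        have h1 : DifferentiableAt ℂ (Function.update x'.1 J) (φ p.2) :=
          (hasFDerivAt_update x'.1 (φ p.2)).differentiableAt
        have h2 : DifferentiableWithinAt ℂ (fun p : ℂ × ℂ => φ p.2) ({s : ℂ | 0 < s.re} ×ˢ {s : ℂ | 0 < s.re}) p :=
          ((differentiableOn_cayleyDisc (ξ J) (r J)) p.2 hp.2).comp p differentiableWithinAt_snd
            (fun q hq => hq.2)
        exact h1.comp_differentiableWithinAt p h2
    have hcomp := hk.comp hinner (fun p hp => ⟨hembP' x hp.1, hembP x' hp.2⟩)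
    refine hcomp.congr fun p _ => ?_
    simp [hk', Function.uncurry, Function.comp]
  -- (2) sesqui-holomorphic form of `K'`
  have hK'eq : ∀ (x x' : X) (s s' : ℂ), 0 < s.re → 0 < s'.re →
      K' (x, s) (x', s') = k' x x' (conj s) s' := by
    intro x x' s s' hs hs'
    simp only [hK', hk', hemb]
    rw [hK _ (hembP x hs) _ (hembP x' hs'), ← Function.update_star, hφ, Complex.star_def,
      ← cayleyDisc_conj]
  -- (3) positivity on the real points of the parameter fibration = positivity on the stage `j`
  have hpos' : IsPosSemidefKernelOn K' {p : X × ℂ | 0 < p.2.re ∧ p.2.im = 0} := by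
    refine hpos.comp emb fun p hp => ?_
    refine ⟨hembP p.1 hp.1, fun i hi => ?_⟩
    rcases eq_or_ne i J with rfl | hiJ
    · simp only [hemb, Function.update_self, hφ]
      rw [← Complex.re_add_im p.2, hp.2, Complex.ofReal_zero, zero_mul, add_zero]
      exact cayleyDisc_ofReal_im _ _ _
    · simp only [hemb, Function.update_of_ne hiJ]
      exact p.1.2.2 i hi
  -- Glaser's lemma in the `J`-th coordinate
  have hmain := isPosSemidefKernelOn_halfPlane_of_ofReal (X := X) (K := K') (k := k') hk'T hK'eq hpos'
  -- (4) pull back to the stage `j + 1`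
  have hpre_mem : ∀ z ∈ realStage P (j + 1), Function.update z J ((ξ J : ℝ) : ℂ) ∈ realStage P j := by
    intro z hz
    refine ⟨update_mem_polydisc hz.1 J (mem_ball_self (hr J)), fun i hi => ?_⟩
    rcases eq_or_ne i J with rfl | hiJ
    · simp
    · rw [Function.update_of_ne hiJ]
      refine hz.2 i ?_
      have : i.val ≠ j := fun h => hiJ (Fin.ext h)
      omega
  classical
  set pre : (Fin m → ℂ) → X × ℂ := fun z =>
    (if hz : z ∈ realStage P (j + 1) then ⟨Function.update z J ((ξ J : ℝ) : ℂ), hpre_mem z hz⟩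
      else ⟨fun i => (ξ i : ℂ), ⟨ofReal_mem_polydisc hr, fun i _ => Complex.ofReal_im _⟩⟩,
     cayleyDiscInv (ξ J) (r J) (z J)) with hpre
  have hpre_re : ∀ z ∈ realStage P (j + 1), 0 < (pre z).2.re := fun z hz =>
    cayleyDiscInv_re_pos (hr J) (mem_polydisc.1 hz.1 J)
  have hemb_pre : ∀ z ∈ realStage P (j + 1), emb (pre z) = z := by
    intro z hz
    simp only [hemb, hpre, dif_pos hz, hφ]
    rw [Function.update_idem, cayleyDisc_cayleyDiscInv (hr J) (mem_polydisc.1 hz.1 J),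
      Function.update_eq_self]
  have hcomp := hmain.comp pre fun z hz => hpre_re z hz
  exact hcomp.of_eqOn fun x hx y hy => by
    show K x y = K (emb (pre x)) (emb (pre y))
    rw [hemb_pre x hx, hemb_pre y hy]

/-- **Glaser's lemma on polydiscs: positive-definiteness propagates from the real points of a
real-centred polydisc to the whole polydisc.** Let `P = D(ξ, r) ⊆ ℂᵐ` be the open polydisc with
real centre `ξ ∈ ℝᵐ` and radii `rᵢ > 0`, and `K` a kernel with `K (w, z) = k (w̄, z)` on `P × P`
for a `k` jointly holomorphic on `P × P`. If `K` is positive-semidefinite on `P ∩ ℝᵐ`, then `K` is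
positive-semidefinite on `P` (V. Glaser (1974), §2; the positivity input of Osterwalder–Schrader
II, (P_N), (5.17)–(5.21)). [cite: GlaserCMP1974, §2] -/
theorem isPosSemidefKernelOn_polydisc_of_real {ξ r : Fin m → ℝ} (hr : ∀ i, 0 < r i)
    {K k : (Fin m → ℂ) → (Fin m → ℂ) → ℂ}
    (hk : DifferentiableOn ℂ (Function.uncurry k)
      (polydisc (fun i => (ξ i : ℂ)) r ×ˢ polydisc (fun i => (ξ i : ℂ)) r))
    (hK : ∀ w ∈ polydisc (fun i => (ξ i : ℂ)) r, ∀ z ∈ polydisc (fun i => (ξ i : ℂ)) r,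
      K w z = k (star w) z)
    (hpos : IsPosSemidefKernelOn K {z | z ∈ polydisc (fun i => (ξ i : ℂ)) r ∧ ∀ i, (z i).im = 0}) :
    IsPosSemidefKernelOn K (polydisc (fun i => (ξ i : ℂ)) r) := by
  have key : ∀ j ≤ m, IsPosSemidefKernelOn K (realStage (polydisc (fun i => (ξ i : ℂ)) r) j) := by
    intro j hj
    induction j with
    | zero => rwa [realStage_zero]
    | succ j ih =>
      exact isPosSemidefKernelOn_realStage_succ hr hk hK (Nat.lt_of_succ_le hj) (ih (Nat.le_of_succ_le hj))
  simpa only [realStage_self] using key m le_rfl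

end Polydisc

end Literature.Analysis.Complex
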